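import Summits.PneNP.PneNP.Theses.CanonicalForms
import Literature.NumberTheory.NumberFields.NumberFieldCanonicalForms

/-!
# Crux `PEqNotCF` (stmt-PneNP-0947) — line `nf-witness-split` (crux-strategist, BC2 redirect)

The typed decomposition of the route target `PEqNotCF` (= Fortnow–Grochow's `CF ≠ PEq`) along the
route's number-field engine — the thesis slogan "easy to compare, impossible to name", typed:

* `stub_numberFieldNoCF` — "impossible to name": VERBATIM the existing rank-2 crux
  `Summit.PneNP.PneNP.Theses.CanonicalForms.NumberFieldNoCF` (stmt-PneNP-0948, OPEN; its own line:
  `Cruxes/NumberFieldNoCF/Lines/quadratic-slice.lean`);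
* `stub_nfIsoPEq` — "easy to compare": number-field isomorphism (invalid strings lumped) is a
  `P`-decidable equivalence relation — PROVED in the tree:
  `Literature.NumberTheory.NumberFields.nfIsoPEq_witness` (p141323; Landau 1985 / A. K. Lenstra
  1983 / LLL 1982 formalised on `TM2`, `nfIso_mem_P_holds`). Kept as a registered stub so the line
  records both pieces; close it with `exact Literature.NumberTheory.NumberFields.nfIsoPEq_witness`.
* `PEqNotCF_of` — the assembly, kernel-checked and LANDED:
  `Literature.NumberTheory.NumberFields.pEq_not_CF_of_noCanonicalDefiningPoly` (p141323, axioms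
  `propext/Classical.choice/Quot.sound`): an `FP` canonical form of the `PEq` relation, restricted to
  codes of monic irreducible polynomials, IS a polynomial-time canonical defining polynomial.

The formal `route edit --split PEqNotCF --into NumberFieldNoCF NFIsoPEq --glue-by …` is prepared
(`Cruxes/PEqNotCF/SPLIT-RECIPE.md`); the gate serves `--split` on a seat's final cycle only.
-/

set_option linter.dupNamespace false

namespace Summit.PneNP.PneNP.Cruxes.PEqNotCF.NfWitnessSplit

open Summit.PneNP.PneNP.Theses.CanonicalForms

/-- **stub (OPEN — the existing crux `NumberFieldNoCF`, stmt-PneNP-0948, verbatim)**: number fields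
have no polynomial-time canonical defining polynomial. -/
theorem stub_numberFieldNoCF :
    ¬ ∃ c ∈ Literature.Computability.Complexity.FP, (∀ p : Polynomial ℤ, p.Monic → Irreducible p → ∃ l : List ℤ, Literature.Computability.Complexity.encodingIntBool.listBool.decode (c (Literature.Computability.Complexity.encodingIntBool.listBool.encode ((List.range (p.natDegree + 1)).map p.coeff))) = some l ∧ (∑ i : Fin l.length, Polynomial.monomial (i : ℕ) (l.get i)).Monic ∧ Irreducible (∑ i : Fin l.length, Polynomial.monomial (i : ℕ) (l.get i)) ∧ Nonempty (AdjoinRoot (((∑ i : Fin l.length, Polynomial.monomial (i : ℕ) (l.get i))).map (Int.castRingHom ℚ)) ≃ₐ[ℚ] AdjoinRoot ((p).map (Int.castRingHom ℚ)))) ∧ ∀ p q : Polynomial ℤ, p.Monic → Irreducible p → q.Monic → Irreducible q → Nonempty (AdjoinRoot ((p).map (Int.castRingHom ℚ)) ≃ₐ[ℚ] AdjoinRoot ((q).map (Int.castRingHom ℚ))) → c (Literature.Computability.Complexity.encodingIntBool.listBool.encode ((List.range (p.natDegree + 1)).map p.coeff)) = c (Literature.Computability.Complexity.encodingIntBool.listBool.encode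 ((List.range (q.natDegree + 1)).map q.coeff)) := by
  sorry

/-- **stub (PROVED in tree, no `sorry`)**: number-field isomorphism, lumped on invalid strings, is a
`P`-decidable equivalence relation (a `PEq` witness in the inlined shape `NFIsoPEq`) —
`Literature.NumberTheory.NumberFields.nfIsoPEq_witness` (p141323). -/
theorem stub_nfIsoPEq :
    ∃ E : List Bool → List Bool → Prop, (∀ x y : List Bool, E x y ↔ ((∃ p q : Polynomial ℤ, Literature.Computability.Complexity.encodingIntBool.listBool.encode ((List.range (p.natDegree + 1)).map p.coeff) = x ∧ Literature.Computability.Complexity.encodingIntBool.listBool.encode ((List.range (q.natDegree + 1)).map q.coeff) = y ∧ (p.Monic ∧ Irreducible p) ∧ (q.Monic ∧ Irreducible q) ∧ Nonempty (AdjoinRoot (p.map (Int.castRingHom ℚ)) ≃ₐ[ℚ] AdjoinRoot (q.map (Int.castRingHom ℚ)))) ∨ ((¬ ∃ p : Polynomial ℤ, (p.Monic ∧ Irreducible p) ∧ Literature.Computability.Complexity.encodingIntBool.listBool.encode ((List.range (p.natDegree + 1)).map p.coeff) = x) ∧ ¬ ∃ q : Polynomial ℤ, (q.Monic ∧ Irreducible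 q) ∧ Literature.Computability.Complexity.encodingIntBool.listBool.encode ((List.range (q.natDegree + 1)).map q.coeff) = y))) ∧ Equivalence E ∧ ({w | ∃ x y, w = Literature.Computability.Complexity.boolPair x y ∧ E x y} : Language Bool) ∈ Literature.Computability.Complexity.Classes.P :=
  Literature.NumberTheory.NumberFields.nfIsoPEq_witness

/-- **Composition (kernel-checked): the crux `PEqNotCF` BY NAME from the two declared stubs** (the file's
only `sorry` is `stub_numberFieldNoCF`, the open piece). -/
theorem PEqNotCF_of : PEqNotCF :=
  Literature.NumberTheory.NumberFields.pEq_not_CF_of_noCanonicalDefiningPoly stub_numberFieldNoCF stub_nfIsoPEq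

/-- Sanity: the first stub is literally the route decl `NumberFieldNoCF` (definitional unfolding). -/
example : (¬ ∃ c ∈ Literature.Computability.Complexity.FP, (∀ p : Polynomial ℤ, p.Monic → Irreducible p → ∃ l : List ℤ, Literature.Computability.Complexity.encodingIntBool.listBool.decode (c (Literature.Computability.Complexity.encodingIntBool.listBool.encode ((List.range (p.natDegree + 1)).map p.coeff))) = some l ∧ (∑ i : Fin l.length, Polynomial.monomial (i : ℕ) (l.get i)).Monic ∧ Irreducible (∑ i : Fin l.length, Polynomial.monomial (i : ℕ) (l.get i)) ∧ Nonempty (AdjoinRoot (((∑ i : Fin l.length, Polynomial.monomial (i : ℕ) (l.get i))).map (Int.castRingHom ℚ)) ≃ₐ[ℚ] AdjoinRoot ((p).map (Int.castRingHom ℚ)))) ∧ ∀ p q : Polynomial ℤ, p.Monic → Irreducible p → q.Monic → Irreducible q → Nonempty (AdjoinRoot ((p).map (Int.castRingHom ℚ)) ≃ₐ[ℚ] AdjoinRoot ((q).map (Int.castRingHom ℚ))) → c (Literature.Computability.Complexity.encodingIntBool.listBool.encode ((List.range (p.natDegree + 1)).map p.coeff)) = c (Literature.Computability.Complexity.encodingIntBool.listBool.encode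 ((List.range (q.natDegree + 1)).map q.coeff))) ↔ NumberFieldNoCF := Iff.rfl

end Summit.PneNP.PneNP.Cruxes.PEqNotCF.NfWitnessSplit
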